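import Mathlib
import Summits.Ventures.CertifiedManyBodySolver.Upper.PlaneConeIneq

/-!
# (P-PEEL) peeled-cone certificates — the kernel of the soundness argument (off-tree twin; reader B «plane-rb» 0.10)

HONEST FRAMING: first certified bounds programme; not a superconductivity verdict. This file checks the two
matrix facts the (P-PEEL) verifier (`planerb/peel.py`, PROPOSAL-peel.md; UPPER-IDEA-2 §16 T-PEEL) relies on:

* `krausPull_range_posSemidef`: a unital Kraus pull `G ↦ ∑ p, (K p)ᴴ G (K p)` (`∑ (K p)ᴴ K p = 1`; every
  brick pull, partial-trace adjoint and their compositions are of this form) preserves `c • 1 - G ⪰ 0`;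
* `peel_posSemidef` / `peel_re_le`: if the group operator is the sum of the pulled blocks,
  `h = ∑ β, H β` (the Lagrangian identity of the relaxation, an operator identity because every constraint's
  two multiplier images cancel on true marginals), and every pulled block obeys `c β • 1 - H β ⪰ 0`, then
  `(∑ β, c β) • 1 - h ⪰ 0`, i.e. `λ_max(h) ≤ ∑ β, c β` — what the verifier adds into `c⁺`.
-/

open Matrix BigOperators Finset
open scoped ComplexOrder

namespace Summit.Ventures.CertifiedManyBodySolver.Upper.PlanePeelBound

section Kraus

variable {m n κ : Type*} [Fintype m] [Fintype n] [DecidableEq m] [DecidableEq n]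

/-- **Unital Kraus pulls preserve upper ranges.** If `∑ p ∈ P, (K p)ᴴ * K p = 1` and `c • 1 - G ⪰ 0`, then
`c • 1 - ∑ p ∈ P, (K p)ᴴ * G * K p ⪰ 0` — because the difference is `∑ p, (K p)ᴴ * (c • 1 - G) * K p`,
a sum of congruences of a PSD matrix. -/
theorem krausPull_range_posSemidef (P : Finset κ) (K : κ → Matrix m n ℂ)
    (hK : ∑ p ∈ P, (K p)ᴴ * K p = 1) (G : Matrix m m ℂ) (c : ℂ)
    (hG : (c • (1 : Matrix m m ℂ) - G).PosSemidef) :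
    (c • (1 : Matrix n n ℂ) - ∑ p ∈ P, (K p)ᴴ * G * K p).PosSemidef := by
  have hterm : ∀ p ∈ P, ((K p)ᴴ * (c • (1 : Matrix m m ℂ) - G) * K p).PosSemidef :=
    fun p _ => hG.conjTranspose_mul_mul_same (K p)
  have hS := PlaneConeIneq.posSemidef_sum P _ hterm
  have hexp : ∑ p ∈ P, (K p)ᴴ * (c • (1 : Matrix m m ℂ) - G) * K p
      = c • (1 : Matrix n n ℂ) - ∑ p ∈ P, (K p)ᴴ * G * K p := by
    have h1 : ∀ p ∈ P, (K p)ᴴ * (c • (1 : Matrix m m ℂ) - G) * K p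
        = c • ((K p)ᴴ * K p) - (K p)ᴴ * G * K p := by
      intro p _
      rw [Matrix.mul_sub, Matrix.sub_mul, Matrix.mul_smul, Matrix.mul_one, Matrix.smul_mul]
    rw [Finset.sum_congr rfl h1, Finset.sum_sub_distrib, ← Finset.smul_sum, hK]
  rw [hexp] at hS
  exact hS

end Kraus

section Peel

variable {n ι : Type*} [Fintype n] [DecidableEq n]

omit [Fintype n] in
/-- **(P-PEEL) assembly.** If `h = ∑ β ∈ s, H β` and every block satisfies `c β • 1 - H β ⪰ 0`, then
`(∑ β ∈ s, c β) • 1 - h ⪰ 0`. -/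
theorem peel_posSemidef (s : Finset ι) (H : ι → Matrix n n ℂ) (c : ι → ℂ) (h : Matrix n n ℂ)
    (hid : h = ∑ β ∈ s, H β) (hβ : ∀ β ∈ s, (c β • (1 : Matrix n n ℂ) - H β).PosSemidef) :
    ((∑ β ∈ s, c β) • (1 : Matrix n n ℂ) - h).PosSemidef := by
  have hS := PlaneConeIneq.posSemidef_sum s _ hβ
  have halg : ∑ β ∈ s, (c β • (1 : Matrix n n ℂ) - H β) = (∑ β ∈ s, c β) • (1 : Matrix n n ℂ) - h := by
    rw [Finset.sum_sub_distrib, ← Finset.sum_smul, hid]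
  rw [halg] at hS
  exact hS

/-- **(P-PEEL), scalar form.** Under the hypotheses of `peel_posSemidef`, every vector `ψ` obeys
`Re⟨ψ, h ψ⟩ ≤ Re(∑ β, c β) · ⟨ψ, ψ⟩`. -/
theorem peel_re_le (s : Finset ι) (H : ι → Matrix n n ℂ) (c : ι → ℂ) (h : Matrix n n ℂ)
    (hid : h = ∑ β ∈ s, H β) (hβ : ∀ β ∈ s, (c β • (1 : Matrix n n ℂ) - H β).PosSemidef)
    (ψ : n → ℂ) :
    (star ψ ⬝ᵥ h.mulVec ψ).re ≤ ((∑ β ∈ s, c β) * (star ψ ⬝ᵥ ψ)).re :=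
  PlaneConeIneq.re_dotProduct_mulVec_le h _ (peel_posSemidef s H c h hid hβ) ψ

/-- **(P-PEEL) with Kraus-pulled blocks** — the form the verifier checks: block tests `c β • 1 - G β ⪰ 0` on the
SMALL blocks, unital Kraus pulls `Λ β` to the group's slice, and the peel identity `h = ∑ β, Λ β (G β)`. -/
theorem peel_kraus_posSemidef {m κ : Type*} [Fintype m] [DecidableEq m]
    (s : Finset ι) (P : ι → Finset κ) (K : ι → κ → Matrix m n ℂ)
    (hK : ∀ β ∈ s, ∑ p ∈ P β, (K β p)ᴴ * K β p = 1)
    (G : ι → Matrix m m ℂ) (c : ι → ℂ) (h : Matrix n n ℂ)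
    (hid : h = ∑ β ∈ s, ∑ p ∈ P β, (K β p)ᴴ * G β * K β p)
    (hG : ∀ β ∈ s, (c β • (1 : Matrix m m ℂ) - G β).PosSemidef) :
    ((∑ β ∈ s, c β) • (1 : Matrix n n ℂ) - h).PosSemidef :=
  peel_posSemidef s (fun β => ∑ p ∈ P β, (K β p)ᴴ * G β * K β p) c h hid
    (fun β hb => krausPull_range_posSemidef (P β) (K β) (hK β hb) (G β) (c β) (hG β hb))

end Peel

end Summit.Ventures.CertifiedManyBodySolver.Upper.PlanePeelBound
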